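import Mathlib.CategoryTheory.Shift.ShiftedHom
import Mathlib.CategoryTheory.Preadditive.AdditiveFunctor
import Mathlib.Algebra.BigOperators.Pi
import Mathlib.Algebra.Group.Pi.Lemmas
import HarnessLib

/-!
# Venture HSemireg — route R1.0, complex carriers: **the triangular Leibniz re-expansion of the traced powers, on
# `ShiftedHom` carriers** (gs-g4 gen 22, brick C8 of `general-structure/COMPLEX-LEIBNIZ-PLAN-gs-g4.md`; the
# `ShiftedHom` twin of gen 20's `UntwistLeibnizTriangular` on `Ext` carriers)

HONEST FRAMING. Pure shifted-Hom algebra in a preadditive category `D` with a shift by `ℤ` whose shift functors are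
additive (think `D = D(Mod 𝒪_X)`); every geometric input is a HYPOTHESIS. Nothing about any variety; nothing here says
HC, HC_CM or HC_AV is proved.

SETTING (all data hypotheses). `E′ : D` (think `Q(E₀ ⊗ M)`), `G_j : D` (`Q((E₀ ⊗ M) ⊗ Ωʲ)`),
`β_j ∈ ShiftedHom(G_j, G_{j+1}, 1)` (the twisted Atiyah steps `At_j(E₀ ⊗ M)`), `γ_j ∈ ShiftedHom(G_j, G_{j+1}, 1)`
(the classes `ν_j = 1 ⊗ [dlog c]`), additive "traces" `Tr′_i : ShiftedHom(E′, G_i, i + 2) → W_i`, "cups"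
`K_i : W_i → W_{i+1}`, and a bound `N` on the form degree. The ONE-SIDED form of the Leibniz data: a family
`S′_i ∈ ShiftedHom(E′, G_i, i + 2)` (think `S′_i = θ(x · ι · At(E₀)^i) · [λ_i]`) is LEIBNIZ when
`S′_j · β_j = S′_{j+1} + S′_j · γ_j` (this is what g21's Leibniz step `At_j(E₀ ⊗ M) = λ⁻¹ θ(At_j E₀) λ + ν_j` gives);
CENTRALITY `γ_m · β_{m+1} = β_m · γ_{m+1}` (gs-g4 g22 `AtiyahNuCommute`); LINEARITY `Tr′_{i+1}(y · γ_i) = K_i(Tr′_i(y))`.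

WHAT IS PROVED (`namespace Summit.Ventures.HSemireg.LeibnizChainShifted`).
* `IsChain G β j q n c` — "`c ∈ ShiftedHom(G_j, G_q, n)` is the chain `β_j · β_{j+1} ⋯ β_{q-1}`" with free endpoints
  and length (no transport along `(j + 1) + k = j + (k + 1)`); `add_eq`, `unique`, `exists_isChain(_of_le)`,
  `exists_cons` (prepending), `comp_central` (pushing a commuting family through), `isChain_of_pow` (recursively
  defined powers — e.g. `complexAtiyahPower` — are chains).
* **`exists_triangular_chain`** / **`exists_triangular`**: for `q ≤ N` there are additive `V_i : W_i → W_q` such that for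
  EVERY Leibniz family `S′` and every chain `c = β_j ⋯ β_{q-1}`:
  `Tr′_q(S′_j · c) = Tr′_q(S′_q) + Σ_{i<q} V_i(Tr′_i(S′_i))` — induction on the length: prepend `β_j`, apply Leibniz,
  push `γ_j` through the rest of the chain by centrality, use linearity. With `j = 0`, `c = B_q = β_0 ⋯ β_{q-1}`,
  `S′_0 = θ(x) · [ι′]` and a comparison `Tr′_i(S′_i) = d_i(σ_i(x))` this is literally the triangular hypothesis `hσ` of
  th-4's `isISemiregularC_iff_isISemiregularC_of_triangular`, with the mixing maps EXISTENTIAL.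

## References

* R.-O. Buchweitz, H. Flenner, *A semiregularity map for modules and applications to deformations*, Compositio
  Math. 137 (2003), §4 (the algebra `A`, `At^k`, the trace), Def. 4.1. [BuchweitzFlenner2003]
* M. F. Atiyah, *Complex analytic connections in fibre bundles*, Trans. AMS 85 (1957), Prop. 10, Prop. 12. [Atiyah1957]
-/

noncomputable section

open CategoryTheory CategoryTheory.Limits Finset

namespace Summit.Ventures.HSemireg

namespace LeibnizChainShifted

universe t v u

variable {D : Type u} [Category.{v} D] [HasShift D ℤ]

/-! ### Chains `β_j · β_{j+1} ⋯ β_{q-1}` with free endpoints -/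

section Chain

variable (G : ℕ → D) (β : ∀ j, ShiftedHom (G j) (G (j + 1)) (1 : ℤ))

/-- **`c ∈ ShiftedHom(G_j, G_q, n)` is the chain `β_j · β_{j+1} ⋯ β_{q-1}`** (Mathlib `ShiftedHom.comp` order; the
empty chain at `G_j` is `mk₀ 𝟙`, and a chain ending at `G_q` extends to `G_{q+1}` by `· β_q`, exactly like
`complexAtiyahPower`). Start, end and length are indices of the predicate. [folklore] -/
inductive IsChain : ∀ (j q n : ℕ), ShiftedHom (G j) (G q) (n : ℤ) → Prop
  | nil (j : ℕ) : IsChain j j 0 (ShiftedHom.mk₀ (0 : ℤ) rfl (𝟙 (G j)))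
  | snoc {j q n : ℕ} {c : ShiftedHom (G j) (G q) (n : ℤ)} (h : IsChain j q n c) :
      IsChain j (q + 1) (n + 1) (c.comp (β q) (by omega))

variable {G β}

/-- `mk₀ 𝟙 · g = g · mk₀ 𝟙` in any common degree (absorbs the casts `0 + 1 = 1 + 0`). [folklore] -/
theorem mk₀_id_comp_eq_comp_mk₀_id {X Y : D} {a₀ b d : ℤ} (ha₀ : a₀ = 0) (g : ShiftedHom X Y b) (p₁ : b + a₀ = d)
    (p₂ : a₀ + b = d) :
    (ShiftedHom.mk₀ a₀ ha₀ (𝟙 X)).comp g p₁ = g.comp (ShiftedHom.mk₀ a₀ ha₀ (𝟙 Y)) p₂ := by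
  subst ha₀
  obtain rfl : d = b := by omega
  rw [ShiftedHom.mk₀_id_comp, ShiftedHom.comp_mk₀_id]

/-- `f · mk₀ 𝟙 = f` when the composition is typed in the cast degree `((0 : ℕ) : ℤ)` (as for the empty chain).
[folklore] -/
theorem comp_mk₀_id_cast {X Y : D} {a : ℤ} (f : ShiftedHom X Y a) (p : ((0 : ℕ) : ℤ) + a = a) :
    ShiftedHom.comp (b := ((0 : ℕ) : ℤ)) f (ShiftedHom.mk₀ (0 : ℤ) rfl (𝟙 Y)) p = f :=
  ShiftedHom.comp_mk₀_id f ((0 : ℕ) : ℤ) (by simp)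

/-- The length of a chain is the difference of its endpoints: `j + n = q`. [folklore] -/
theorem IsChain.add_eq {j q n : ℕ} {c : ShiftedHom (G j) (G q) (n : ℤ)} (h : IsChain G β j q n c) : j + n = q := by
  induction h with
  | nil => rfl
  | snoc _ ih => omega

/-- A chain is determined by its endpoints (and length). [folklore] -/
theorem IsChain.unique {j q n : ℕ} {c c' : ShiftedHom (G j) (G q) (n : ℤ)} (h : IsChain G β j q n c)
    (h' : IsChain G β j q n c') : c = c' := by
  induction h with
  | nil =>
    cases h'
    rfl
  | snoc h ih =>
    cases h' with
    | snoc h'' => rw [ih h'']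

variable (G β) in
/-- The chain `β_j ⋯ β_{j+k-1} ∈ ShiftedHom(G_j, G_{j+k}, k)` exists. [folklore] -/
theorem exists_isChain (j k : ℕ) : ∃ c : ShiftedHom (G j) (G (j + k)) (k : ℤ), IsChain G β j (j + k) k c := by
  induction k with
  | zero => exact ⟨ShiftedHom.mk₀ (0 : ℤ) rfl (𝟙 _), IsChain.nil j⟩
  | succ k ih =>
    obtain ⟨c, hc⟩ := ih
    exact ⟨c.comp (β (j + k)) (by omega), hc.snoc⟩

variable (G β) in
/-- The chain from `G_j` to `G_q` exists whenever `j ≤ q`. [folklore] -/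
theorem exists_isChain_of_le {j q : ℕ} (hjq : j ≤ q) :
    ∃ (n : ℕ) (c : ShiftedHom (G j) (G q) (n : ℤ)), IsChain G β j q n c := by
  obtain ⟨k, rfl⟩ := Nat.exists_eq_add_of_le hjq
  exact ⟨k, exists_isChain G β j k⟩

/-- **Prepending**: a chain `β_j ⋯ β_{q-1}` of length `m = n + 1` is `β_j · (β_{j+1} ⋯ β_{q-1})`. [folklore] -/
theorem IsChain.exists_cons {j q m : ℕ} {c : ShiftedHom (G j) (G q) (m : ℤ)} (h : IsChain G β j q m c) {n : ℕ}
    (hm : m = n + 1) :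
    ∃ c' : ShiftedHom (G (j + 1)) (G q) (n : ℤ), IsChain G β (j + 1) q n c' ∧ c = (β j).comp c' (by omega) := by
  induction h generalizing n with
  | nil => exact absurd hm.symm (Nat.succ_ne_zero n)
  | @snoc q₁ n₁ c₁ h₁ ih =>
    obtain rfl : n = n₁ := (Nat.succ_injective hm).symm
    cases h₁ with
    | nil => exact ⟨ShiftedHom.mk₀ (0 : ℤ) rfl (𝟙 _), IsChain.nil (j + 1), mk₀_id_comp_eq_comp_mk₀_id rfl (β j) _ _⟩
    | @snoc q₂ n₂ c₂ h₂ =>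
      obtain ⟨c', hc', e⟩ := ih rfl
      refine ⟨c'.comp (β (q₂ + 1)) (by omega), hc'.snoc, ?_⟩
      rw [e]
      exact ShiftedHom.comp_assoc (β j) c' (β (q₂ + 1)) (by omega) (by omega) (by omega)

/-- **Pushing a commuting family through a chain**: if `γ_m · β_{m+1} = β_m · γ_{m+1}` for all `m` with `m + 1 < M`,
then for a chain `c = β_j ⋯ β_{q-1}` with `q < M`, `c · γ_q = γ_j · c⁺` where `c⁺ = β_{j+1} ⋯ β_q`. [folklore] -/
theorem IsChain.comp_central {M : ℕ} (γ : ∀ j, ShiftedHom (G j) (G (j + 1)) (1 : ℤ))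
    (hγ : ∀ m, m + 1 < M → (γ m).comp (β (m + 1)) (rfl : (1 : ℤ) + 1 = 2) = (β m).comp (γ (m + 1)) rfl)
    {j q n : ℕ} {c : ShiftedHom (G j) (G q) (n : ℤ)} (h : IsChain G β j q n c) (hq : q < M) :
    ∃ c' : ShiftedHom (G (j + 1)) (G (q + 1)) (n : ℤ), IsChain G β (j + 1) (q + 1) n c' ∧
      c.comp (γ q) (show (1 : ℤ) + n = ((n + 1 : ℕ) : ℤ) by omega) = (γ j).comp c' (by omega) := by
  induction h with
  | nil => exact ⟨ShiftedHom.mk₀ (0 : ℤ) rfl (𝟙 _), IsChain.nil (j + 1), mk₀_id_comp_eq_comp_mk₀_id rfl (γ j) _ _⟩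
  | @snoc q₁ n₁ c₁ h₁ ih =>
    obtain ⟨c', hc', e⟩ := ih (by omega)
    refine ⟨c'.comp (β (q₁ + 1)) (by omega), hc'.snoc, ?_⟩
    rw [ShiftedHom.comp_assoc c₁ (β q₁) (γ (q₁ + 1)) (by omega) rfl (by omega), ← hγ q₁ hq,
      ← ShiftedHom.comp_assoc c₁ (γ q₁) (β (q₁ + 1)) (show (1 : ℤ) + n₁ = ((n₁ + 1 : ℕ) : ℤ) by omega) rfl
        (by omega), e]
    exact ShiftedHom.comp_assoc (γ j) c' (β (q₁ + 1)) (by omega) (by omega) (by omega)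

/-- **Recursively defined powers are chains**: if `B_0 = mk₀ 𝟙` and `B_{q+1} = B_q · β_q` (e.g. `complexAtiyahPower`),
then `B_q` is the chain `β_0 ⋯ β_{q-1}`. [folklore] -/
theorem isChain_of_pow (B : ∀ q : ℕ, ShiftedHom (G 0) (G q) (q : ℤ)) (hB0 : B 0 = ShiftedHom.mk₀ (0 : ℤ) rfl (𝟙 _))
    (hBs : ∀ q, B (q + 1) = (B q).comp (β q) (by omega)) (q : ℕ) : IsChain G β 0 q q (B q) := by
  induction q with
  | zero => rw [hB0]; exact IsChain.nil 0
  | succ q ih => rw [hBs]; exact ih.snoc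

end Chain

/-! ### The triangular re-expansion -/

section Triangular

variable [Preadditive D]
  {E' : D} {G : ℕ → D} (β γ : ∀ j, ShiftedHom (G j) (G (j + 1)) (1 : ℤ))
  {W : ℕ → Type t} [∀ i, AddCommMonoid (W i)]
  (Tr' : ∀ i : ℕ, ShiftedHom E' (G i) ((i : ℤ) + 2) →+ W i) (K : ∀ i, W i →+ W (i + 1)) (N : ℕ)

variable (hcen : ∀ m, m + 1 < N → (γ m).comp (β (m + 1)) (rfl : (1 : ℤ) + 1 = 2) = (β m).comp (γ (m + 1)) rfl)
  (hlin : ∀ i, i + 1 ≤ N → ∀ y : ShiftedHom E' (G i) ((i : ℤ) + 2),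
    Tr' (i + 1) (y.comp (γ i) (show (1 : ℤ) + ((i : ℤ) + 2) = ((i + 1 : ℕ) : ℤ) + 2 by omega)) = K i (Tr' i y))

include hcen hlin in
/-- **The triangular re-expansion along a chain.** For `j + k = q ≤ N` there are additive `V_i : W_i → W_q` such that
for every Leibniz family `S′` and every chain `c = β_j ⋯ β_{q-1}`:
`Tr′_q(S′_j · c) = Tr′_q(S′_q) + Σ_{i<q} V_i(Tr′_i(S′_i))`. [cite: BuchweitzFlenner2003, §4 and Def. 4.1] -/
theorem exists_triangular_chain (k : ℕ) : ∀ (j q : ℕ), j + k = q → q ≤ N →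
    ∃ V : ∀ i, W i →+ W q, ∀ (S' : ∀ i : ℕ, ShiftedHom E' (G i) ((i : ℤ) + 2))
      (_ : ∀ j, j + 1 ≤ N → (S' j).comp (β j) (show (1 : ℤ) + ((j : ℤ) + 2) = ((j + 1 : ℕ) : ℤ) + 2 by omega) =
        S' (j + 1) + (S' j).comp (γ j) (by omega))
      (n : ℕ) (c : ShiftedHom (G j) (G q) (n : ℤ)) (_ : IsChain G β j q n c) (h : (n : ℤ) + ((j : ℤ) + 2) = (q : ℤ) + 2),
      Tr' q ((S' j).comp c h) = Tr' q (S' q) + ∑ i ∈ range q, V i (Tr' i (S' i)) := by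
  induction k with
  | zero =>
    intro j q hjq hqN
    obtain rfl : j = q := by omega
    refine ⟨fun _ => 0, fun S' _ n c hc h => ?_⟩
    have hn : n = 0 := by have := hc.add_eq; omega
    subst hn
    cases hc with
    | nil => rw [comp_mk₀_id_cast]; simp only [AddMonoidHom.zero_apply, sum_const_zero, add_zero]
  | succ k ih =>
    intro j q hjq hqN
    obtain ⟨q₀, rfl⟩ : ∃ q₀, q = q₀ + 1 := ⟨j + k, by omega⟩
    obtain ⟨V₁, hV₁⟩ := ih (j + 1) (q₀ + 1) (by omega) hqN
    obtain ⟨V₀, hV₀⟩ := ih j q₀ (by omega) (by omega)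
    refine ⟨fun i => V₁ i + (if i < q₀ then (K q₀).comp (V₀ i) else 0) +
      Pi.single (M := fun i => W i →+ W (q₀ + 1)) q₀ (K q₀) i, fun S' hS' n c hc h => ?_⟩
    -- the chain is `β_j · c'`, `c' = β_{j+1} ⋯ β_{q₀}`
    obtain ⟨n', rfl⟩ : ∃ n', n = n' + 1 := ⟨k, by have := hc.add_eq; omega⟩
    obtain ⟨c', hc', rfl⟩ := hc.exists_cons rfl
    -- `γ_j · c' = c₀ · γ_{q₀}` with `c₀ = β_j ⋯ β_{q₀-1}`
    obtain ⟨n₀, c₀, hc₀⟩ := exists_isChain_of_le G β (show j ≤ q₀ by omega)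
    obtain rfl : n' = n₀ := by have := hc₀.add_eq; have := hc'.add_eq; omega
    have hjn : j + n' = q₀ := hc₀.add_eq
    obtain ⟨c'', hc'', hcomm⟩ := hc₀.comp_central γ hcen (show q₀ < N by omega)
    obtain rfl : c' = c'' := hc'.unique hc''
    -- reassociate and apply the Leibniz rule
    rw [← ShiftedHom.comp_assoc (S' j) (β j) c' (show (1 : ℤ) + ((j : ℤ) + 2) = ((j + 1 : ℕ) : ℤ) + 2 by omega)
      (by omega) (by omega), hS' j (by omega), ShiftedHom.add_comp, map_add]
    -- second term: `(S′_j · γ_j) · c' = (S′_j · c₀) · γ_{q₀}`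
    have h2 : ((S' j).comp (γ j) (show (1 : ℤ) + ((j : ℤ) + 2) = ((j + 1 : ℕ) : ℤ) + 2 by omega)).comp c'
          (show (n' : ℤ) + (((j + 1 : ℕ) : ℤ) + 2) = ((q₀ + 1 : ℕ) : ℤ) + 2 by omega) =
        ((S' j).comp c₀ (show (n' : ℤ) + ((j : ℤ) + 2) = (q₀ : ℤ) + 2 by omega)).comp (γ q₀)
          (show (1 : ℤ) + ((q₀ : ℤ) + 2) = ((q₀ + 1 : ℕ) : ℤ) + 2 by omega) := by
      rw [ShiftedHom.comp_assoc (S' j) (γ j) c' (show (1 : ℤ) + ((j : ℤ) + 2) = ((j + 1 : ℕ) : ℤ) + 2 by omega)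
        (show (n' : ℤ) + 1 = ((n' + 1 : ℕ) : ℤ) by omega) (by omega), ← hcomm,
        ← ShiftedHom.comp_assoc (S' j) c₀ (γ q₀) (show (n' : ℤ) + ((j : ℤ) + 2) = (q₀ : ℤ) + 2 by omega)
          (show (1 : ℤ) + n' = ((n' + 1 : ℕ) : ℤ) by omega) (by omega)]
    rw [h2, hV₁ S' hS' n' c' hc', hlin q₀ (by omega), hV₀ S' hS' n' c₀ hc₀]
    -- bookkeeping of the mixing maps
    simp only [AddMonoidHom.add_apply, sum_add_distrib, map_add, map_sum]
    have hite : ∑ i ∈ range (q₀ + 1), (if i < q₀ then (K q₀).comp (V₀ i) else 0) (Tr' i (S' i)) =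
        ∑ i ∈ range q₀, K q₀ (V₀ i (Tr' i (S' i))) := by
      rw [sum_range_succ, if_neg (lt_irrefl q₀), AddMonoidHom.zero_apply, add_zero]
      exact sum_congr rfl fun i hi => by rw [if_pos (mem_range.mp hi)]; rfl
    have hsingle : ∑ i ∈ range (q₀ + 1), (Pi.single (M := fun i => W i →+ W (q₀ + 1)) q₀ (K q₀) i) (Tr' i (S' i)) =
        K q₀ (Tr' q₀ (S' q₀)) := by
      rw [sum_eq_single_of_mem q₀ (mem_range.mpr (Nat.lt_succ_self q₀))
        (fun i _ hi => by rw [Pi.single_eq_of_ne hi, AddMonoidHom.zero_apply]), Pi.single_eq_same]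
    rw [hite, hsingle]
    abel

include hcen hlin in
/-- **The triangular Leibniz re-expansion of the traced powers** (all rows `q ≤ N`): for recursively defined powers
`B_q = β_0 ⋯ β_{q-1}` (`B_0 = mk₀ 𝟙`, `B_{q+1} = B_q · β_q`, e.g. `complexAtiyahPower (E₀ ⊗ M)`) there are additive maps
`V_i : W_i → W_q` with `Tr′_q(S′_0 · B_q) = Tr′_q(S′_q) + Σ_{i<q} V_i(Tr′_i(S′_i))` for EVERY Leibniz family `S′` — read
(with `S′_0 = θ x · [ι′]`, `Tr′_i(S′_i) = d_i(σ_i(x))`): `σ′_q(θ x) = d_q(σ_q x) + Σ_{i<q} u_{q,i}(σ_i x)`, the hypothesis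
`hσ` of th-4's `isISemiregularC_iff_isISemiregularC_of_triangular`, mixing maps EXISTENTIAL.
[cite: BuchweitzFlenner2003, Def. 4.1 and §5; Atiyah1957, Prop. 10 and Prop. 12] -/
theorem exists_triangular (B : ∀ q : ℕ, ShiftedHom (G 0) (G q) (q : ℤ)) (hB0 : B 0 = ShiftedHom.mk₀ (0 : ℤ) rfl (𝟙 _))
    (hBs : ∀ q, B (q + 1) = (B q).comp (β q) (by omega)) (q : ℕ) (hq : q ≤ N) :
    ∃ V : ∀ i, W i →+ W q, ∀ (S' : ∀ i : ℕ, ShiftedHom E' (G i) ((i : ℤ) + 2))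
      (_ : ∀ j, j + 1 ≤ N → (S' j).comp (β j) (show (1 : ℤ) + ((j : ℤ) + 2) = ((j + 1 : ℕ) : ℤ) + 2 by omega) =
        S' (j + 1) + (S' j).comp (γ j) (by omega)),
      Tr' q ((S' 0).comp (B q) (by omega)) = Tr' q (S' q) + ∑ i ∈ range q, V i (Tr' i (S' i)) := by
  obtain ⟨V, hV⟩ := exists_triangular_chain β γ Tr' K N hcen hlin q 0 q (by omega) hq
  exact ⟨V, fun S' hS' => hV S' hS' q (B q) (isChain_of_pow B hB0 hBs q) _⟩

end Triangular

end LeibnizChainShifted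

end Summit.Ventures.HSemireg

end
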